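import Literature.MathematicalPhysics.QuantumFieldTheory.Balaban1983to89.B8Prop6CubeMember
import Literature.MathematicalPhysics.QuantumFieldTheory.Balaban1983to89.B8Thm4ConcreteAt

/-!
# `Balaban1983to89.B8Prop6CubeMemberFlat` — [Balaban1985RegularSpaces] PROPOSITION 6 (p. 99) AT THE CONCRETE CUBE MEMBER, MODULO THE FOUR
# SOCKET BODIES **AT THE FLAT DATUM `(1, U₀″)` ONLY** — the form in which print uses Theorem 4 on p. 99 («for the pair of configurations
# 1, U₀″») and in which the remaining hypotheses are statements about the FLAT operators of [B5]∕[4]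

statement-level skeleton of published theorems with citation tags; proofs where landed; nothing here is a claim about the
Yang–Mills mass gap

T. Bałaban, *Spaces of regular gauge field configurations on a lattice and gauge fixing conditions*, Commun. Math. Phys. **99**
(1985) 75–102 `[Balaban1985RegularSpaces]` ("B8"), Sect. F pp. 98–99, Theorem 4 p. 88, Proposition 5 p. 94, (1.59) p. 86.

CITATION HEADER (lean-in-tree rule).  Cell `pub-ymgap` (YM Track A, HUMAN RULING D-0062), DAG node N05 = [B8], seat `pub-ymgap-dag-n05-c`
(R134 fan-out; FAN-OUT v1.1 §N05 row s3b, kernel half, module 2′).  `B8Prop6CubeMember.prop6_exists_cubeMember` takes the four sockets of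
the N05 knit AT THE CUBE MEMBER, i.e. quantified over EVERY background `U₀ ∈ 𝔄_k({□_j}, ·)`; print's Proposition 6 uses Theorem 4 at the
background `1` only.  THIS module re-derives the same conclusion from the per-datum driver `B8Thm4ConcreteAt.thm4Body_concrete_at`, so
that the displayed hypotheses are the four socket BODIES at the flat datum `(U₀, U′) := (1, U₀″)`, `(α₀, α₁) := (L³α₀, 6dL²Mα₀)`:
Proposition 5's fixed point (base and step) for the pair `1, U₀″`, (1.59) = [4] Thm 3.3 in Prop. 3's frame for `G(1)` on the cube family,
Proposition 5's uniqueness (1.109) at background `1`.  Kind «kernel-checked proof», ONE theorem, no `def`.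

HONEST SCOPE.  The four displayed bodies are NOT discharged here (object-bound; their letters are the flat multi-level operators, for
which the tree holds `B8Ineq192MultiLevelBox`, `B8Ineq198MultiLevelBox`, `B6Prop23MultiLevelBox`, `B8Prop3MultiLevelTorus*` on torus ∕
Neumann-box carriers — the dictionary to the `ℤᵈ` carrier of this member is NOT in the tree).  Everything else as in `B8Prop6CubeMember`
(HONEST SCOPE there).  Count-neutral; N05 NOT discharged; nothing continuum ∕ ℝ⁴ ∕ OS ∕ mass-gap ∕ Clay.  Unit `pub-ymgap-dag-n05-c` (g0),
2026-08-26.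
VERSION v1.1 (same seat, APPEND-ONLY §2): `prop6_asPrinted_cubeMember_at` — the same with EXACTLY print's hypotheses («7dL²Mα₀ ≤ c₁»,
`L ≤ dM`, printed constant `7dL²B₁Mα₀`; the (1.130)-regime conditions absorbed via `B8Prop6CubeMember.regime_of_printed_smallness`).  §1 unchanged.
-/

noncomputable section

namespace Literature.MathematicalPhysics.QuantumFieldTheory.Balaban1983to89.B8Prop6CubeMemberFlat

open B7Prop1Explicit B7Prop2Explicit B7Prop1Local B7Eq92Concrete B8Ineq130
open B7Prop2Explicit (C0 c2')
open B8Ineq132 (covDerivFwd InAk pdevOn_lt_of_inAk)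
open B8Ineq133 (cutFixed)
open B8Eq115GaugeFixing (localGauge)
open B8Eq119TwistedAxial (InAx Restr129)
open B8Eq184Proof (gaugeExp cfgExp)
open B8Lemma1NonAbelian (mulCfg)
open B8Eq140Level (SideTouches)
open B8Eq146AExpansion (iEta)
open B7Prop4GeneralLevels (linCovIter)
open B8Eq155JBound (Jcur wsup)
open B8ScaledSupNorm (bondNorm msup)
open B8Thm2LogB (blockTop)
open B8Eq138LandauZd (IsLandau138W logCfg)
open B8Eq131Cubes (tcube tLo tHi ctr tLo_le_tHi)
open B8Eq131CubesAdmissible (cubeFam)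
open B8Prop6OfThm4 (localGauge_mem agree135 smallness_134 const_136)
open B8CubeMemberZd (cubeLamS cubeLamB hΩ_cubeFam hbox_cubeLamB hclass_cubeLamB htower_cubeLam hpart_cubeLam)
open B8Prop6CubeMember (thm4_hypotheses_one_cutFixed regime_of_printed_smallness)
open B8Thm4ConcreteAt (thm4Body_concrete_at)

export B7Prop1Explicit (Site)

variable {d : ℕ}

variable {𝔸 : Type} [CStarAlgebra 𝔸] [Nontrivial 𝔸]

/-- **PROPOSITION 6 (p. 99) AT THE CONCRETE CUBE MEMBER, MODULO THE FOUR SOCKET BODIES AT THE FLAT DATUM `(1, U₀″)`** (print: «the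
assumptions of Theorem 4 are satisfied for the pair of configurations 1, U₀″, thus there exists a gauge transformation u such that
U₁ = U₀″^{u⁻¹} satisfies …»).  ONE threshold `c₁(d, L, B₀, B₀′, cu) > 0` (= `B8Thm4ConcreteAt.thm4Body_concrete_at`'s); for every cube datum
`(η > 0, k ≥ 1, a, L ≤ ρ ≤ M, 11d < M)`, every unitary `U₀ ∈ 𝔄_k({Ω_j}, α₀)` with `□̃ ⊂ Ω_{k−1}` in the regime of (1.130) and
`L³α₀ + 6dL²Mα₀ ≤ c₁`, IF (i) Proposition 5's fixed point holds at the base level for the pair `(1, U₀″)`, (ii) at every intermediate level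
`1 ≤ m < k` for the intermediate data over `(1, U₀″)`, (iii) (1.59) holds at background `1` for the fields gauge-related to `U₀″` in the Landau
gauge of record, (iv) Proposition 5's uniqueness (1.109) holds at background `1` for the competitors over `(1, U₀″)` — THEN the conclusion of
`B8Prop6CubeMember.prop6_exists_cubeMember`: a unitary `u`, `= 1` off `□₀`, with (1.29), (1.38) of record, the (1.62)-shape
`|A| ≤ 5dLB₀(L³α₀ + 6dL²Mα₀)(Lʲη)⁻¹`, unique among such, and (1.135) `U₀^{w⁻¹} = U₀″^{u⁻¹}` on `□̃`, `w = v⁻¹u` unitary.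
[cite: Balaban1985RegularSpaces, Prop. 6 (1.135)–(1.136) p.99, p.99 (sentence after (1.133)), Thm 4 p.88, Prop. 5 (1.107)–(1.109) p.94, (1.59) p.86] -/
theorem prop6_exists_cubeMember_at (hd2 : 2 ≤ d) {L : ℕ} (hL : 2 ≤ L) {B₀ B₀' cu : ℝ} (hB₀ : 0 < B₀) (hB₀' : 0 < B₀')
    (hB : 2 ≤ 5 * (d : ℝ) * L * B₀) (hcu : 0 < cu) :
    ∃ c₁ : ℝ, 0 < c₁ ∧ ∀ (η : ℝ), 0 < η → ∀ (k : ℕ), 1 ≤ k → ∀ (a : Site d) (M ρ : ℕ), L ≤ ρ → ρ ≤ M → 11 * (d : ℝ) < M →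
      ∀ (U₀ : Site d → Fin d → 𝔸ˣ), (∀ x κ, U₀ x κ ∈ unitaryUnits 𝔸) → ∀ (α₀ : ℝ), 0 < α₀ →
      C0 d * (α₀ * (L : ℝ) ^ 2) ≤ 1 / 3 → 2 * (α₀ * (L : ℝ) ^ 2) ≤ c2' d L →
      ∀ (Ω : ℕ → Set (Site d)), InAk L k η α₀ Ω U₀ → tcube L a M ρ k ⊆ Ω (k - 1) →
      11 * (d : ℝ) ^ 2 * (L : ℝ) ^ 2 * α₀ + ((M : ℝ) + 4 * ρ) * d * (L : ℝ) ^ 2 * α₀ ≤ 1 / 6 →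
      (L : ℝ) ^ 3 * α₀ + 6 * d * (L : ℝ) ^ 2 * M * α₀ ≤ c₁ →
      ((∃ (v : Site d → 𝔸ˣ) (lam : Site d → 𝔸), (∀ x, v x ∈ unitaryUnits 𝔸) ∧ (∀ x, x ∉ (cubeFam false L a M ρ k) 0 → v x = 1) ∧
        (∀ j, j ≤ 1 → ∀ b ∈ {b : Site d × Fin d | SideTouches ((cubeFam false L a M ρ k) j) b.1 b.2}, (v b.1 : 𝔸) = ((gaugeExp lam b.1 : 𝔸ˣ) : 𝔸) ∧
        (v (b.1 + e b.2) : 𝔸) = ((gaugeExp lam (b.1 + e b.2) : 𝔸ˣ) : 𝔸)) ∧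
        (∀ j, j ≤ 1 → ∀ b ∈ {b : Site d × Fin d | SideTouches ((cubeFam false L a M ρ k) j) b.1 b.2},
        ‖lam b.1‖ ≤ (8 * B₀' * (5 * (d : ℝ) * L * B₀) * (((L : ℝ) ^ 3 * α₀) + (6 * d * (L : ℝ) ^ 2 * M * α₀))) ∧
          ((L : ℝ) ^ j * η) * ‖covDerivFwd η (1 : Site d → Fin d →
          𝔸ˣ) b.2 lam b.1‖ ≤ (8 * B₀' * (5 * (d : ℝ) * L * B₀) * (((L : ℝ) ^ 3 * α₀) + (6 * d * (L : ℝ) ^ 2 * M * α₀)))) ∧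
        IsLandau138W L 1 η ((cubeFam false L a M ρ k) 0) ((cubeLamS L a M ρ k) 1) (1 : Site d → Fin d → 𝔸ˣ) (mgauge (1 : Site d → Fin d →
          𝔸ˣ) v⁻¹ (cutFixed L (tLo a ρ) (tHi a M ρ) U₀ k (ctr a M))) ∧ Restr129 L 1 ((cubeLamS L a M ρ k) 1) (1 : Site d → Fin d → 𝔸ˣ) ((1 : Site d →
          𝔸ˣ) * v))) →
      ((∀ m, 1 ≤ m → m < k → ∀ (u₁ : Site d → 𝔸ˣ) (U₁ : Site d → Fin d → 𝔸ˣ) (A : Site d → Fin d → 𝔸),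
        (∀ x, u₁ x ∈ unitaryUnits 𝔸) → (∀ x, x ∉ (cubeFam false L a M ρ k) 0 → u₁ x = 1) → mgauge (1 : Site d → Fin d →
          𝔸ˣ) u₁ U₁ = (cutFixed L (tLo a ρ) (tHi a M ρ) U₀ k (ctr a M)) → Restr129 L m ((cubeLamS L a M ρ k) m) (1 : Site d → Fin d → 𝔸ˣ) u₁ →
        IsLandau138W L m η ((cubeFam false L a M ρ k) 0) ((cubeLamS L a M ρ k) m) (1 : Site d → Fin d → 𝔸ˣ) U₁ →
        (∀ j, j ≤ m → ∀ b ∈ {b : Site d × Fin d | SideTouches ((cubeFam false L a M ρ k) j) b.1 b.2},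
        U₁ b.1 b.2 = cfgExp η A b.1 b.2 ∧ IsSelfAdjoint (A b.1 b.2) ∧
          ‖A b.1 b.2‖ ≤ (5 * (d : ℝ) * L * B₀ * (((L : ℝ) ^ 3 * α₀) + (6 * d * (L : ℝ) ^ 2 * M * α₀))) * ((L : ℝ) ^ j * η)⁻¹) →
        ∃ (v : Site d → 𝔸ˣ) (lam : Site d → 𝔸), (∀ x, v x ∈ unitaryUnits 𝔸) ∧ (∀ x, x ∉ (cubeFam false L a M ρ k) 0 → v x = 1) ∧
        (∀ j, j ≤ m + 1 →
          ∀ b ∈ {b : Site d × Fin d | SideTouches ((cubeFam false L a M ρ k) j) b.1 b.2}, (v b.1 : 𝔸) = ((gaugeExp lam b.1 : 𝔸ˣ) : 𝔸) ∧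
        (v (b.1 + e b.2) : 𝔸) = ((gaugeExp lam (b.1 + e b.2) : 𝔸ˣ) : 𝔸)) ∧
        (∀ j, j ≤ m + 1 → ∀ b ∈ {b : Site d × Fin d | SideTouches ((cubeFam false L a M ρ k) j) b.1 b.2},
        ‖lam b.1‖ ≤ (8 * B₀' * (5 * (d : ℝ) * L * B₀) * (((L : ℝ) ^ 3 * α₀) + (6 * d * (L : ℝ) ^ 2 * M * α₀))) ∧
          ((L : ℝ) ^ j * η) * ‖covDerivFwd η (1 : Site d → Fin d →
          𝔸ˣ) b.2 lam b.1‖ ≤ (8 * B₀' * (5 * (d : ℝ) * L * B₀) * (((L : ℝ) ^ 3 * α₀) + (6 * d * (L : ℝ) ^ 2 * M * α₀)))) ∧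
        IsLandau138W L (m + 1) η ((cubeFam false L a M ρ k) 0) ((cubeLamS L a M ρ k) (m + 1)) (1 : Site d → Fin d → 𝔸ˣ) (mgauge (1 : Site d → Fin d →
          𝔸ˣ) v⁻¹ U₁) ∧ Restr129 L (m + 1) ((cubeLamS L a M ρ k) (m + 1)) (1 : Site d → Fin d → 𝔸ˣ) (u₁ * v))) →
      ((∀ m, 1 ≤ m → m ≤ k → ∀ (u : Site d → 𝔸ˣ) (W : Site d → Fin d → 𝔸ˣ) (A' : Site d → Fin d → 𝔸),
        (∀ x, u x ∈ unitaryUnits 𝔸) → mgauge (1 : Site d → Fin d → 𝔸ˣ) u W = (cutFixed L (tLo a ρ) (tHi a M ρ) U₀ k (ctr a M)) →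
          Restr129 L m ((cubeLamS L a M ρ k) m) (1 : Site d → Fin d → 𝔸ˣ) u →
          IsLandau138W L m η ((cubeFam false L a M ρ k) 0) ((cubeLamS L a M ρ k) m) (1 : Site d → Fin d → 𝔸ˣ) W →
        (∀ y τ, IsSelfAdjoint (A' y τ)) →
        (∀ j, j ≤ m → ∀ y τ, SideTouches ((cubeFam false L a M ρ k) j) y τ →
        W y τ = cfgExp η A' y τ ∧
          ‖A' y τ‖ ≤ (2 * (L * (5 * (d : ℝ) * L * B₀ * (((L : ℝ) ^ 3 * α₀) + (6 * d * (L : ℝ) ^ 2 * M * α₀)))) + 8 * (8 * B₀' * (5 * (d : ℝ) * L * B₀) * (((L : ℝ) ^ 3 * α₀) + (6 * d * (L : ℝ) ^ 2 * M * α₀)))) * ((L : ℝ) ^ j * η)⁻¹) →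
        (∀ y τ, (∀ j, j ≤ m → ¬ SideTouches ((cubeFam false L a M ρ k) j) y τ) → A' y τ = 0) →
        msup L m η (-(1 : ℝ)) (fun j (b : Site d × Fin d) => SideTouches ((cubeFam false L a M ρ k) j) b.1 b.2) (fun b => A' b.1 b.2)
        ≤ B₀ * (bondNorm L m η (-(3 : ℝ)) (cubeFam false L a M ρ k) (fun x μ => Jcur η (1 : Site d → Fin d → 𝔸ˣ) A' μ x)
        + wsup 1 (fun p : {p : ℕ × (Site d × Fin d) // p.1 ≤ m ∧ p.2 ∈ (cubeLamB L a M ρ k) m p.1} =>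
        linCovIter L (1 : Site d → Fin d → 𝔸ˣ) (iEta η A') p.1.1 p.1.2.1 p.1.2.2)) ∧
        msup L m η (-(2 : ℝ)) (fun j (t : Fin d × Fin d × Site d) => SideTouches ((cubeFam false L a M ρ k) j) t.2.2 t.2.1)
        (fun t => covDerivFwd η (1 : Site d → Fin d → 𝔸ˣ) t.1 (fun z => A' z t.2.1) t.2.2)
        ≤ B₀ * (bondNorm L m η (-(3 : ℝ)) (cubeFam false L a M ρ k) (fun x μ => Jcur η (1 : Site d → Fin d → 𝔸ˣ) A' μ x)
        + wsup 1 (fun p : {p : ℕ × (Site d × Fin d) // p.1 ≤ m ∧ p.2 ∈ (cubeLamB L a M ρ k) m p.1} =>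
        linCovIter L (1 : Site d → Fin d → 𝔸ˣ) (iEta η A') p.1.1 p.1.2.1 p.1.2.2)))) →
      (∀ u₁ : Site d → 𝔸ˣ, (∀ x, u₁ x ∈ unitaryUnits 𝔸) → Restr129 L k ((cubeLamS L a M ρ k) k) (1 : Site d → Fin d → 𝔸ˣ) u₁ →
      ∀ (v w : Site d → 𝔸ˣ) (lam mu : Site d → 𝔸),
      (∀ j, j ≤ k → ∀ y ∈ (cubeLamS L a M ρ k) k j, ∀ x : Site d, InBox (tlo L y j) (thi L y j) x →
        ((gaugeExp lam x : 𝔸ˣ) : 𝔸) = ((v x : 𝔸ˣ) : 𝔸) ∧ IsSelfAdjoint (lam x) ∧ ‖lam x‖ < cu ∧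
          ∀ κ : Fin d, InBox (tlo L y j) (thi L y j) (x + e κ) → ((L : ℝ) ^ j * η) * ‖covDerivFwd η (1 : Site d → Fin d → 𝔸ˣ) κ lam x‖ < cu) →
      (∀ j, j ≤ k → ∀ y ∈ (cubeLamS L a M ρ k) k j, ∀ x : Site d, InBox (tlo L y j) (thi L y j) x →
        ((gaugeExp mu x : 𝔸ˣ) : 𝔸) = ((w x : 𝔸ˣ) : 𝔸) ∧ IsSelfAdjoint (mu x) ∧ ‖mu x‖ < cu ∧
          ∀ κ : Fin d, InBox (tlo L y j) (thi L y j) (x + e κ) → ((L : ℝ) ^ j * η) * ‖covDerivFwd η (1 : Site d → Fin d → 𝔸ˣ) κ mu x‖ < cu) →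
      IsLandau138W L k η ((cubeFam false L a M ρ k) 0) ((cubeLamS L a M ρ k) k) (1 : Site d → Fin d → 𝔸ˣ) (mgauge (1 : Site d → Fin d →
        𝔸ˣ) v⁻¹ (mgauge (1 : Site d → Fin d → 𝔸ˣ) u₁⁻¹ (cutFixed L (tLo a ρ) (tHi a M ρ) U₀ k (ctr a M)))) →
        Restr129 L k ((cubeLamS L a M ρ k) k) (1 : Site d → Fin d → 𝔸ˣ) (u₁ * v) →
      IsLandau138W L k η ((cubeFam false L a M ρ k) 0) ((cubeLamS L a M ρ k) k) (1 : Site d → Fin d → 𝔸ˣ) (mgauge (1 : Site d → Fin d →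
        𝔸ˣ) w⁻¹ (mgauge (1 : Site d → Fin d → 𝔸ˣ) u₁⁻¹ (cutFixed L (tLo a ρ) (tHi a M ρ) U₀ k (ctr a M)))) →
        Restr129 L k ((cubeLamS L a M ρ k) k) (1 : Site d → Fin d → 𝔸ˣ) (u₁ * w) →
      ∀ j, j ≤ k → ∀ y ∈ (cubeLamS L a M ρ k) k j, ∀ x : Site d, InBox (tlo L y j) (thi L y j) x → v x = w x) →
      ∃ u : Site d → 𝔸ˣ, (∀ x, u x ∈ unitaryUnits 𝔸) ∧ (∀ x, x ∉ cubeFam false L a M ρ k 0 → u x = 1) ∧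
        Restr129 L k (cubeLamS L a M ρ k k) (1 : Site d → Fin d → 𝔸ˣ) u ∧
        IsLandau138W L k η (cubeFam false L a M ρ k 0) (cubeLamS L a M ρ k k) (1 : Site d → Fin d → 𝔸ˣ)
          (gaugeAct u⁻¹ (cutFixed L (tLo a ρ) (tHi a M ρ) U₀ k (ctr a M))) ∧
        (∀ j, j ≤ k → ∀ b ∈ {b : Site d × Fin d | SideTouches (cubeFam false L a M ρ k j) b.1 b.2},
          gaugeAct u⁻¹ (cutFixed L (tLo a ρ) (tHi a M ρ) U₀ k (ctr a M)) b.1 b.2 =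
              cfgExp η (logCfg η (gaugeAct u⁻¹ (cutFixed L (tLo a ρ) (tHi a M ρ) U₀ k (ctr a M)))) b.1 b.2 ∧
            IsSelfAdjoint (logCfg η (gaugeAct u⁻¹ (cutFixed L (tLo a ρ) (tHi a M ρ) U₀ k (ctr a M))) b.1 b.2) ∧
            ‖logCfg η (gaugeAct u⁻¹ (cutFixed L (tLo a ρ) (tHi a M ρ) U₀ k (ctr a M))) b.1 b.2‖ ≤
              (5 * (d : ℝ) * L * B₀ * ((L : ℝ) ^ 3 * α₀ + 6 * d * (L : ℝ) ^ 2 * M * α₀)) * ((L : ℝ) ^ j * η)⁻¹) ∧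
        (∀ u' : Site d → 𝔸ˣ, (∀ x, u' x ∈ unitaryUnits 𝔸) → (∀ x, x ∉ cubeFam false L a M ρ k 0 → u' x = 1) →
          Restr129 L k (cubeLamS L a M ρ k k) (1 : Site d → Fin d → 𝔸ˣ) u' →
          IsLandau138W L k η (cubeFam false L a M ρ k 0) (cubeLamS L a M ρ k k) (1 : Site d → Fin d → 𝔸ˣ)
            (gaugeAct u'⁻¹ (cutFixed L (tLo a ρ) (tHi a M ρ) U₀ k (ctr a M))) →
          (∃ A' : Site d → Fin d → 𝔸, ∀ j, j ≤ k → ∀ (x : Site d) (κ : Fin d), SideTouches (cubeFam false L a M ρ k j) x κ →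
            gaugeAct u'⁻¹ (cutFixed L (tLo a ρ) (tHi a M ρ) U₀ k (ctr a M)) x κ = cfgExp η A' x κ ∧
              ‖A' x κ‖ ≤ (5 * (d : ℝ) * L * B₀ * ((L : ℝ) ^ 3 * α₀ + 6 * d * (L : ℝ) ^ 2 * M * α₀)) * ((L : ℝ) ^ j * η)⁻¹) →
          u' = u) ∧
        (∀ x, ((localGauge L (tLo a ρ) (tHi a M ρ) U₀ k (ctr a M))⁻¹ * u) x ∈ unitaryUnits 𝔸) ∧
        AgreeOn (tlo L (tLo a ρ) k) (thi L (tHi a M ρ) k)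
          (gaugeAct ((localGauge L (tLo a ρ) (tHi a M ρ) U₀ k (ctr a M))⁻¹ * u)⁻¹ U₀)
          (gaugeAct u⁻¹ (cutFixed L (tLo a ρ) (tHi a M ρ) U₀ k (ctr a M))) := by
  have hL1 : 1 ≤ L := le_trans (by norm_num) hL
  have hd1 : 1 ≤ d := le_trans (by norm_num) hd2
  obtain ⟨c₁, hc₁, H⟩ := thm4Body_concrete_at (𝔸 := 𝔸) hd2 hL hB₀ hB₀' hB hcu
  refine ⟨c₁, hc₁, ?_⟩
  intro η hη k hk a M ρ hρL hρM hM U₀ hU₀ α₀ hα hα3 hα2 Ω hA hT hsmall hc P5base₁ P5step₁ H59₁ P5u₁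
  have hρ : 1 ≤ ρ := hL1.trans hρL
  have hM1 : 1 ≤ M := hρ.trans hρM
  have hLpos : (0 : ℝ) < L := by exact_mod_cast lt_of_lt_of_le (by norm_num) hL
  have hdpos : (0 : ℝ) < d := by exact_mod_cast hd1
  have hMpos : (0 : ℝ) < M := by exact_mod_cast hM1
  have hα₀' : 0 < (L : ℝ) ^ 3 * α₀ := by positivity
  have hα₁' : 0 < 6 * (d : ℝ) * (L : ℝ) ^ 2 * M * α₀ := by positivity
  obtain ⟨hmem, h33, h34, hAx, h135, h66⟩ :=
    thm4_hypotheses_one_cutFixed L hL hd1 k U₀ hU₀ hα hα3 hα2 a hρ hρM hM hη hA hT hsmall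
  have hone : ∀ x κ, (1 : Site d → Fin d → 𝔸ˣ) x κ ∈ unitaryUnits 𝔸 := fun _ _ => (unitaryUnits 𝔸).one_mem
  obtain ⟨u, hu, huS, h129, hLan, h162, huniq⟩ := H η hη k (cubeFam false L a M ρ k) (hΩ_cubeFam hL1 a M hρL k)
    (cubeLamS L a M ρ k) (cubeLamB L a M ρ k) (hbox_cubeLamB L a M ρ k) (hclass_cubeLamB L a M ρ k) (htower_cubeLam hL1 a M ρ k)
    (hpart_cubeLam hL1 a M ρ k) _ _ hα₀' hα₁' hc 1 _ hone hmem h33 h34 hAx h135 h66 P5base₁ P5step₁ H59₁ P5u₁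
  simp only [mgauge_one_left] at hLan h162 huniq
  have hΩ' : ∃ l, l ≤ k ∧ k ≤ l + 1 ∧ ∀ x, InBox (tlo L (tLo a ρ) k) (thi L (tHi a M ρ) k) x → x ∈ Ω l :=
    ⟨k - 1, Nat.sub_le _ _, by omega, fun x hx => hT hx⟩
  have hvG : ∀ x, localGauge L (tLo a ρ) (tHi a M ρ) U₀ k (ctr a M) x ∈ unitaryUnits 𝔸 :=
    localGauge_mem L hL (avgClosed_unitaryUnits (𝔸 := 𝔸) d L) k U₀ hU₀ hα hα3 hα2 (tLo_le_tHi hM1)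
      (pdevOn_lt_of_inAk hL1 hα hA hΩ') (ctr a M)
  refine ⟨u, hu, huS, h129, hLan hk, h162, fun u' hu' hu'S hR' hLan' hA' => huniq u' hu' hu'S hR' hLan' hA' hk,
    fun x => (unitaryUnits 𝔸).mul_mem ((unitaryUnits 𝔸).inv_mem (hvG x)) (hu x), agree135 _ _ U₀ _ u⟩

#print axioms prop6_exists_cubeMember_at

/-! ## §2 (v1.1) Print's hypotheses exactly, flat socket bodies -/

/-- **PROPOSITION 6 (p. 99) AT THE CONCRETE CUBE MEMBER WITH EXACTLY PRINT'S HYPOTHESES, MODULO THE FOUR SOCKET BODIES AT THE FLAT DATUM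
`(1, U₀″)`** — `prop6_exists_cubeMember_at` with the tree's (1.130)-regime conditions absorbed into the threshold
(`B8Prop6CubeMember.regime_of_printed_smallness`) and print's smallness∕constant: «let 7dL²Mα₀ ≤ c₁» (+ the implicit `L ≤ dM`,
`B8Prop6OfThm4.smallness_134`) ⇒ ∃ unitary `u` (= 1 off `□₀`, (1.29) at the member) with `U₀^{w⁻¹} = U₀″^{u⁻¹} = e^{iηA}` on `□̃` ((1.135), `w = v⁻¹u`),
`A` Hermitian, `Lʲη|A| ≤ 7dL²B₁Mα₀` on the bonds of the plaquettes touching `□_j` ((1.136)₁, `B₁ = 5dLB₀`, `const_136`), (1.38) of record,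
unique in the driver's radius.  ONE threshold `c₁(d, L, B₀, B₀′, cu) > 0`. [cite: Balaban1985RegularSpaces, Prop. 6 (1.135)–(1.138) p.99, p.98, (1.134) p.99] -/
theorem prop6_asPrinted_cubeMember_at (hd2 : 2 ≤ d) {L : ℕ} (hL : 2 ≤ L) {B₀ B₀' cu : ℝ} (hB₀ : 0 < B₀) (hB₀' : 0 < B₀')
    (hB : 2 ≤ 5 * (d : ℝ) * L * B₀) (hcu : 0 < cu) :
    ∃ c₁ : ℝ, 0 < c₁ ∧ ∀ (η : ℝ), 0 < η → ∀ (k : ℕ), 1 ≤ k → ∀ (a : Site d) (M ρ : ℕ), L ≤ ρ → ρ ≤ M → 11 * (d : ℝ) < M →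
      (L : ℝ) ≤ d * M →
      ∀ (U₀ : Site d → Fin d → 𝔸ˣ), (∀ x κ, U₀ x κ ∈ unitaryUnits 𝔸) → ∀ (α₀ : ℝ), 0 < α₀ →
      ∀ (Ω : ℕ → Set (Site d)), InAk L k η α₀ Ω U₀ → tcube L a M ρ k ⊆ Ω (k - 1) →
      7 * d * (L : ℝ) ^ 2 * M * α₀ ≤ c₁ →
      ((∃ (v : Site d → 𝔸ˣ) (lam : Site d → 𝔸), (∀ x, v x ∈ unitaryUnits 𝔸) ∧ (∀ x, x ∉ (cubeFam false L a M ρ k) 0 → v x = 1) ∧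
        (∀ j, j ≤ 1 → ∀ b ∈ {b : Site d × Fin d | SideTouches ((cubeFam false L a M ρ k) j) b.1 b.2}, (v b.1 : 𝔸) = ((gaugeExp lam b.1 : 𝔸ˣ) : 𝔸) ∧
        (v (b.1 + e b.2) : 𝔸) = ((gaugeExp lam (b.1 + e b.2) : 𝔸ˣ) : 𝔸)) ∧
        (∀ j, j ≤ 1 → ∀ b ∈ {b : Site d × Fin d | SideTouches ((cubeFam false L a M ρ k) j) b.1 b.2},
        ‖lam b.1‖ ≤ (8 * B₀' * (5 * (d : ℝ) * L * B₀) * (((L : ℝ) ^ 3 * α₀) + (6 * d * (L : ℝ) ^ 2 * M * α₀))) ∧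
          ((L : ℝ) ^ j * η) * ‖covDerivFwd η (1 : Site d → Fin d →
          𝔸ˣ) b.2 lam b.1‖ ≤ (8 * B₀' * (5 * (d : ℝ) * L * B₀) * (((L : ℝ) ^ 3 * α₀) + (6 * d * (L : ℝ) ^ 2 * M * α₀)))) ∧
        IsLandau138W L 1 η ((cubeFam false L a M ρ k) 0) ((cubeLamS L a M ρ k) 1) (1 : Site d → Fin d → 𝔸ˣ) (mgauge (1 : Site d → Fin d →
          𝔸ˣ) v⁻¹ (cutFixed L (tLo a ρ) (tHi a M ρ) U₀ k (ctr a M))) ∧ Restr129 L 1 ((cubeLamS L a M ρ k) 1) (1 : Site d → Fin d → 𝔸ˣ) ((1 : Site d →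
          𝔸ˣ) * v))) →
      ((∀ m, 1 ≤ m → m < k → ∀ (u₁ : Site d → 𝔸ˣ) (U₁ : Site d → Fin d → 𝔸ˣ) (A : Site d → Fin d → 𝔸),
        (∀ x, u₁ x ∈ unitaryUnits 𝔸) → (∀ x, x ∉ (cubeFam false L a M ρ k) 0 → u₁ x = 1) → mgauge (1 : Site d → Fin d →
          𝔸ˣ) u₁ U₁ = (cutFixed L (tLo a ρ) (tHi a M ρ) U₀ k (ctr a M)) → Restr129 L m ((cubeLamS L a M ρ k) m) (1 : Site d → Fin d → 𝔸ˣ) u₁ →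
        IsLandau138W L m η ((cubeFam false L a M ρ k) 0) ((cubeLamS L a M ρ k) m) (1 : Site d → Fin d → 𝔸ˣ) U₁ →
        (∀ j, j ≤ m → ∀ b ∈ {b : Site d × Fin d | SideTouches ((cubeFam false L a M ρ k) j) b.1 b.2},
        U₁ b.1 b.2 = cfgExp η A b.1 b.2 ∧ IsSelfAdjoint (A b.1 b.2) ∧
          ‖A b.1 b.2‖ ≤ (5 * (d : ℝ) * L * B₀ * (((L : ℝ) ^ 3 * α₀) + (6 * d * (L : ℝ) ^ 2 * M * α₀))) * ((L : ℝ) ^ j * η)⁻¹) →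
        ∃ (v : Site d → 𝔸ˣ) (lam : Site d → 𝔸), (∀ x, v x ∈ unitaryUnits 𝔸) ∧ (∀ x, x ∉ (cubeFam false L a M ρ k) 0 → v x = 1) ∧
        (∀ j, j ≤ m + 1 →
          ∀ b ∈ {b : Site d × Fin d | SideTouches ((cubeFam false L a M ρ k) j) b.1 b.2}, (v b.1 : 𝔸) = ((gaugeExp lam b.1 : 𝔸ˣ) : 𝔸) ∧
        (v (b.1 + e b.2) : 𝔸) = ((gaugeExp lam (b.1 + e b.2) : 𝔸ˣ) : 𝔸)) ∧
        (∀ j, j ≤ m + 1 → ∀ b ∈ {b : Site d × Fin d | SideTouches ((cubeFam false L a M ρ k) j) b.1 b.2},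
        ‖lam b.1‖ ≤ (8 * B₀' * (5 * (d : ℝ) * L * B₀) * (((L : ℝ) ^ 3 * α₀) + (6 * d * (L : ℝ) ^ 2 * M * α₀))) ∧
          ((L : ℝ) ^ j * η) * ‖covDerivFwd η (1 : Site d → Fin d →
          𝔸ˣ) b.2 lam b.1‖ ≤ (8 * B₀' * (5 * (d : ℝ) * L * B₀) * (((L : ℝ) ^ 3 * α₀) + (6 * d * (L : ℝ) ^ 2 * M * α₀)))) ∧
        IsLandau138W L (m + 1) η ((cubeFam false L a M ρ k) 0) ((cubeLamS L a M ρ k) (m + 1)) (1 : Site d → Fin d → 𝔸ˣ) (mgauge (1 : Site d → Fin d →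
          𝔸ˣ) v⁻¹ U₁) ∧ Restr129 L (m + 1) ((cubeLamS L a M ρ k) (m + 1)) (1 : Site d → Fin d → 𝔸ˣ) (u₁ * v))) →
      ((∀ m, 1 ≤ m → m ≤ k → ∀ (u : Site d → 𝔸ˣ) (W : Site d → Fin d → 𝔸ˣ) (A' : Site d → Fin d → 𝔸),
        (∀ x, u x ∈ unitaryUnits 𝔸) → mgauge (1 : Site d → Fin d → 𝔸ˣ) u W = (cutFixed L (tLo a ρ) (tHi a M ρ) U₀ k (ctr a M)) →
          Restr129 L m ((cubeLamS L a M ρ k) m) (1 : Site d → Fin d → 𝔸ˣ) u →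
          IsLandau138W L m η ((cubeFam false L a M ρ k) 0) ((cubeLamS L a M ρ k) m) (1 : Site d → Fin d → 𝔸ˣ) W →
        (∀ y τ, IsSelfAdjoint (A' y τ)) →
        (∀ j, j ≤ m → ∀ y τ, SideTouches ((cubeFam false L a M ρ k) j) y τ →
        W y τ = cfgExp η A' y τ ∧
          ‖A' y τ‖ ≤ (2 * (L * (5 * (d : ℝ) * L * B₀ * (((L : ℝ) ^ 3 * α₀) + (6 * d * (L : ℝ) ^ 2 * M * α₀)))) + 8 * (8 * B₀' * (5 * (d : ℝ) * L * B₀) * (((L : ℝ) ^ 3 * α₀) + (6 * d * (L : ℝ) ^ 2 * M * α₀)))) * ((L : ℝ) ^ j * η)⁻¹) →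
        (∀ y τ, (∀ j, j ≤ m → ¬ SideTouches ((cubeFam false L a M ρ k) j) y τ) → A' y τ = 0) →
        msup L m η (-(1 : ℝ)) (fun j (b : Site d × Fin d) => SideTouches ((cubeFam false L a M ρ k) j) b.1 b.2) (fun b => A' b.1 b.2)
        ≤ B₀ * (bondNorm L m η (-(3 : ℝ)) (cubeFam false L a M ρ k) (fun x μ => Jcur η (1 : Site d → Fin d → 𝔸ˣ) A' μ x)
        + wsup 1 (fun p : {p : ℕ × (Site d × Fin d) // p.1 ≤ m ∧ p.2 ∈ (cubeLamB L a M ρ k) m p.1} =>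
        linCovIter L (1 : Site d → Fin d → 𝔸ˣ) (iEta η A') p.1.1 p.1.2.1 p.1.2.2)) ∧
        msup L m η (-(2 : ℝ)) (fun j (t : Fin d × Fin d × Site d) => SideTouches ((cubeFam false L a M ρ k) j) t.2.2 t.2.1)
        (fun t => covDerivFwd η (1 : Site d → Fin d → 𝔸ˣ) t.1 (fun z => A' z t.2.1) t.2.2)
        ≤ B₀ * (bondNorm L m η (-(3 : ℝ)) (cubeFam false L a M ρ k) (fun x μ => Jcur η (1 : Site d → Fin d → 𝔸ˣ) A' μ x)
        + wsup 1 (fun p : {p : ℕ × (Site d × Fin d) // p.1 ≤ m ∧ p.2 ∈ (cubeLamB L a M ρ k) m p.1} =>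
        linCovIter L (1 : Site d → Fin d → 𝔸ˣ) (iEta η A') p.1.1 p.1.2.1 p.1.2.2)))) →
      (∀ u₁ : Site d → 𝔸ˣ, (∀ x, u₁ x ∈ unitaryUnits 𝔸) → Restr129 L k ((cubeLamS L a M ρ k) k) (1 : Site d → Fin d → 𝔸ˣ) u₁ →
      ∀ (v w : Site d → 𝔸ˣ) (lam mu : Site d → 𝔸),
      (∀ j, j ≤ k → ∀ y ∈ (cubeLamS L a M ρ k) k j, ∀ x : Site d, InBox (tlo L y j) (thi L y j) x →
        ((gaugeExp lam x : 𝔸ˣ) : 𝔸) = ((v x : 𝔸ˣ) : 𝔸) ∧ IsSelfAdjoint (lam x) ∧ ‖lam x‖ < cu ∧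
          ∀ κ : Fin d, InBox (tlo L y j) (thi L y j) (x + e κ) → ((L : ℝ) ^ j * η) * ‖covDerivFwd η (1 : Site d → Fin d → 𝔸ˣ) κ lam x‖ < cu) →
      (∀ j, j ≤ k → ∀ y ∈ (cubeLamS L a M ρ k) k j, ∀ x : Site d, InBox (tlo L y j) (thi L y j) x →
        ((gaugeExp mu x : 𝔸ˣ) : 𝔸) = ((w x : 𝔸ˣ) : 𝔸) ∧ IsSelfAdjoint (mu x) ∧ ‖mu x‖ < cu ∧
          ∀ κ : Fin d, InBox (tlo L y j) (thi L y j) (x + e κ) → ((L : ℝ) ^ j * η) * ‖covDerivFwd η (1 : Site d → Fin d → 𝔸ˣ) κ mu x‖ < cu) →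
      IsLandau138W L k η ((cubeFam false L a M ρ k) 0) ((cubeLamS L a M ρ k) k) (1 : Site d → Fin d → 𝔸ˣ) (mgauge (1 : Site d → Fin d →
        𝔸ˣ) v⁻¹ (mgauge (1 : Site d → Fin d → 𝔸ˣ) u₁⁻¹ (cutFixed L (tLo a ρ) (tHi a M ρ) U₀ k (ctr a M)))) →
        Restr129 L k ((cubeLamS L a M ρ k) k) (1 : Site d → Fin d → 𝔸ˣ) (u₁ * v) →
      IsLandau138W L k η ((cubeFam false L a M ρ k) 0) ((cubeLamS L a M ρ k) k) (1 : Site d → Fin d → 𝔸ˣ) (mgauge (1 : Site d → Fin d →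
        𝔸ˣ) w⁻¹ (mgauge (1 : Site d → Fin d → 𝔸ˣ) u₁⁻¹ (cutFixed L (tLo a ρ) (tHi a M ρ) U₀ k (ctr a M)))) →
        Restr129 L k ((cubeLamS L a M ρ k) k) (1 : Site d → Fin d → 𝔸ˣ) (u₁ * w) →
      ∀ j, j ≤ k → ∀ y ∈ (cubeLamS L a M ρ k) k j, ∀ x : Site d, InBox (tlo L y j) (thi L y j) x → v x = w x) →
      ∃ u : Site d → 𝔸ˣ, (∀ x, u x ∈ unitaryUnits 𝔸) ∧ (∀ x, x ∉ cubeFam false L a M ρ k 0 → u x = 1) ∧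
        Restr129 L k (cubeLamS L a M ρ k k) (1 : Site d → Fin d → 𝔸ˣ) u ∧
        IsLandau138W L k η (cubeFam false L a M ρ k 0) (cubeLamS L a M ρ k k) (1 : Site d → Fin d → 𝔸ˣ)
          (gaugeAct u⁻¹ (cutFixed L (tLo a ρ) (tHi a M ρ) U₀ k (ctr a M))) ∧
        (∀ j, j ≤ k → ∀ b ∈ {b : Site d × Fin d | SideTouches (cubeFam false L a M ρ k j) b.1 b.2},
          gaugeAct u⁻¹ (cutFixed L (tLo a ρ) (tHi a M ρ) U₀ k (ctr a M)) b.1 b.2 =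
              cfgExp η (logCfg η (gaugeAct u⁻¹ (cutFixed L (tLo a ρ) (tHi a M ρ) U₀ k (ctr a M)))) b.1 b.2 ∧
            IsSelfAdjoint (logCfg η (gaugeAct u⁻¹ (cutFixed L (tLo a ρ) (tHi a M ρ) U₀ k (ctr a M))) b.1 b.2) ∧
            ‖logCfg η (gaugeAct u⁻¹ (cutFixed L (tLo a ρ) (tHi a M ρ) U₀ k (ctr a M))) b.1 b.2‖ ≤
              (7 * d * (L : ℝ) ^ 2 * (5 * (d : ℝ) * L * B₀) * M * α₀) * ((L : ℝ) ^ j * η)⁻¹) ∧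
        (∀ u' : Site d → 𝔸ˣ, (∀ x, u' x ∈ unitaryUnits 𝔸) → (∀ x, x ∉ cubeFam false L a M ρ k 0 → u' x = 1) →
          Restr129 L k (cubeLamS L a M ρ k k) (1 : Site d → Fin d → 𝔸ˣ) u' →
          IsLandau138W L k η (cubeFam false L a M ρ k 0) (cubeLamS L a M ρ k k) (1 : Site d → Fin d → 𝔸ˣ)
            (gaugeAct u'⁻¹ (cutFixed L (tLo a ρ) (tHi a M ρ) U₀ k (ctr a M))) →
          (∃ A' : Site d → Fin d → 𝔸, ∀ j, j ≤ k → ∀ (x : Site d) (κ : Fin d), SideTouches (cubeFam false L a M ρ k j) x κ →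
            gaugeAct u'⁻¹ (cutFixed L (tLo a ρ) (tHi a M ρ) U₀ k (ctr a M)) x κ = cfgExp η A' x κ ∧
              ‖A' x κ‖ ≤ (5 * (d : ℝ) * L * B₀ * ((L : ℝ) ^ 3 * α₀ + 6 * d * (L : ℝ) ^ 2 * M * α₀)) * ((L : ℝ) ^ j * η)⁻¹) →
          u' = u) ∧
        (∀ x, ((localGauge L (tLo a ρ) (tHi a M ρ) U₀ k (ctr a M))⁻¹ * u) x ∈ unitaryUnits 𝔸) ∧
        AgreeOn (tlo L (tLo a ρ) k) (thi L (tHi a M ρ) k)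
          (gaugeAct ((localGauge L (tLo a ρ) (tHi a M ρ) U₀ k (ctr a M))⁻¹ * u)⁻¹ U₀)
          (gaugeAct u⁻¹ (cutFixed L (tLo a ρ) (tHi a M ρ) U₀ k (ctr a M))) := by
  have hL1 : 1 ≤ L := le_trans (by norm_num) hL
  have hd1 : 1 ≤ d := le_trans (by norm_num) hd2
  have hLpos : (0 : ℝ) < L := by exact_mod_cast lt_of_lt_of_le (by norm_num) hL
  have hC0 := C0_pos d
  have hc2 := c2'_pos d L hL1
  obtain ⟨c₀, hc₀, H⟩ := prop6_exists_cubeMember_at (𝔸 := 𝔸) hd2 hL hB₀ hB₀' hB hcu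
  refine ⟨min c₀ (min (7 / (3 * C0 d)) (min (7 * c2' d L / 2) (7 / 36))), ?_, ?_⟩
  · exact lt_min hc₀ (lt_min (by positivity) (lt_min (by positivity) (by norm_num)))
  intro η hη k hk a M ρ hρL hρM hM hLdM U₀ hU₀ α₀ hα Ω hA hT hc P5base₁ P5step₁ H59₁ P5u₁
  have hρ : 1 ≤ ρ := hL1.trans hρL
  have hM1 : 1 ≤ M := hρ.trans hρM
  have hc' : 7 * d * (L : ℝ) ^ 2 * M * α₀ ≤ c₀ := hc.trans (min_le_left _ _)
  have hcA : 7 * d * (L : ℝ) ^ 2 * M * α₀ ≤ min (7 / (3 * C0 d)) (min (7 * c2' d L / 2) (7 / 36)) := hc.trans (min_le_right _ _)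
  obtain ⟨hα3, hα2, hsmall⟩ := regime_of_printed_smallness (L := L) hd1 hM1 hρM hM hα hcA (min_le_left _ _)
    ((min_le_right _ _).trans (min_le_left _ _)) ((min_le_right _ _).trans (min_le_right _ _))
  have hB₁ : 0 ≤ 5 * (d : ℝ) * L * B₀ := by positivity
  obtain ⟨u, hu, huS, h129, hLan, h162, huniq, hw, h135⟩ := H η hη k hk a M ρ hρL hρM hM U₀ hU₀ α₀ hα hα3 hα2 Ω hA hT hsmall
    (smallness_134 hLpos hα hLdM hc') P5base₁ P5step₁ H59₁ P5u₁
  refine ⟨u, hu, huS, h129, hLan, fun j hj b hb => ?_, huniq, hw, h135⟩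
  obtain ⟨h1, h2, h3⟩ := h162 j hj b hb
  refine ⟨h1, h2, h3.trans ?_⟩
  have hη0 : 0 ≤ ((L : ℝ) ^ j * η)⁻¹ := by positivity
  exact mul_le_mul_of_nonneg_right (const_136 hLpos hα hB₁ hLdM) hη0

#print axioms prop6_asPrinted_cubeMember_at

end Literature.MathematicalPhysics.QuantumFieldTheory.Balaban1983to89.B8Prop6CubeMemberFlat

end
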